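import Mathlib
import Summits.NavierStokesRegularity.NavierStokesRegularity.Theorems.DssFarFieldSlavingBlowupTypeIDssProfileGaussianGapCore
import Summits.NavierStokesRegularity.NavierStokesRegularity.Theorems.IsobarTomographyBlobRiccatiClosureTypeIGaugeBounds
import Literature.Analysis.FluidPDE.TypeIAncientMildClassical
import Literature.Analysis.FluidPDE.TaoEnstrophyLocalisation
import Literature.Analysis.FluidPDE.CurlFreeLiouville
import HarnessLib

/-!
# The Gaussian-gap Liouville theorem for Type-I ancient mild solutions (pub-ns-dss theory T41,
  classical level, similarity-variable form `GaussianGapTypeISim`; route `DssFarFieldSlaving`, crux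
  `BlowupTypeIDssProfile`, stmt-NavierStokesRegularity-0155 — SUPPORT; cell pub-ns-dss, typer seat g4,
  2026-08-23; lead A129 precision 4/5; file 4, imports files 1–3)

HONEST FRAMING. A Liouville statement for a SLICE of the Type-I ancient mild class under an explicit
perturbative budget — not a statement about Navier–Stokes regularity or blow-up; an empty slice is a
census ghost index (C13 D-6), never a discard. DERIVED by the cell's theory seat (EXPLICIT-THRESHOLDS T41,
LIOUVILLE-SIDE §8 T41; red g14 ×2 PASS s14 (phys) + red g17 s21 (Sim dictionary); not in print as
searched, LIT-COVERAGE §20/§21); typed here from the analytic core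
`GaussianGap.gaussianGap_vorticity_liouville` (file 3) and the tree's Type-I toolbox.

STATEMENT (`typeI_ancient_gaussianGap_eq_zero`; registered form `gaussianGapTypeISim` = the theory
seat's `GaussianGapTypeISim`, GaussianGapStatements.lean v2 sha256[16] 7d1058abdd5585ce, binder for
binder). Let `V` be a Type-I ancient mild field in the KNSS gauge (`IsTypeIAncientMild C V`, any `C`),
`U = lerayOrbit V`, `Ω = lerayVorticity V` its similarity-variable velocity and vorticity, `K = heatKernel 1`.
If for all `s, y`: `⟪DU(s,y)[Ω], Ω⟫ ≤ Λ|Ω|²` (stretching on the vorticity direction),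
`−⟪y, U(s,y)⟫ ≤ P₋` (inward radial flux), `|∫KΩ(s)|² ≤ μ₀∫K|Ω(s)|²` (Gaussian-mean vorticity
fraction), `∫K|Ω(s)|² ≤ B` (Gaussian enstrophy bound) and `Λ + ¼P₋ + ½μ₀ < 3/2`, then `V ≡ 0` on
`t < 0`.

PROOF. The core theorem's hypotheses are discharged from the class: slices of `U` are smooth
(`contDiff_uncurry_lerayOrbit`) and divergence free (`isDivFree_lerayOrbit_iff`); the CLASS-UNIFORM
SCALE-INVARIANT gauge bounds `√(−t)^{k+1}‖DᵏV(t)‖ ≤ K_k` of the tree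
(`typeIGauge_exists_pow_mul_norm_iteratedFDeriv_le`, KNSS 2009 Prop. 4.1 transported by the parabolic
scaling) give `‖DᵏU(s)‖ ≤ K_k` for ALL `s` (`k ≤ 3`), hence global bounds on `Ω, DΩ, D²Ω, U, DU`; the
equation is the tree's `IsTypeIAncientMild.lerayVorticity_eq`, the `s`-derivative existing by joint
smoothness; so `Ω ≡ 0` by file 3, i.e. every slice `V(t)` is curl free (`curl_lerayOrbit`), hence
constant (`eq_of_curl_eq_zero_of_isDivFree_of_bounded`), hence zero (`eq_zero_of_slice_const`).
REMARK (typer): by the same scale-invariant bounds the Gaussian-enstrophy hypothesis `∫K|Ω(s)|² ≤ B`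
is automatically satisfied with `B = ‖curl‖²K₁²` — `typeI_ancient_gaussianGap_eq_zero'` drops it; the
theory seat's statement keeps it and is typed verbatim. [this file; theory T41]
-/

noncomputable section

set_option linter.dupNamespace false

namespace Summit.NavierStokesRegularity.NavierStokesRegularity.Theorems.GaussianGap

open Set Function Filter MeasureTheory InnerProductSpace Real Metric
open scoped RealInnerProductSpace Laplacian ContDiff Topology BigOperators
open Literature.Analysis Literature.Analysis.FluidPDE Literature.Analysis.UnboundedOperators
open Summit.NavierStokesRegularity.NavierStokesRegularity.Theorems
open Summit.NavierStokesRegularity.NavierStokesRegularity.Theorems.BlobRiccatiClosure.TypeIApexLiouville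

/-! ### Similarity scaling of the slices of a Type-I ancient mild field -/

section Scaling

variable {C : ℝ} {V : ℝ → EuclideanSpace ℝ (Fin 3) → EuclideanSpace ℝ (Fin 3)}

/-- The similarity orbit of a class element is jointly smooth on `ℝ × ℝ³`. [folklore] -/
theorem contDiff_uncurry_lerayOrbit_of_typeI (hV : IsTypeIAncientMild C V) :
    ContDiff ℝ (⊤ : ℕ∞) (uncurry (lerayOrbit V)) :=
  contDiff_uncurry_lerayOrbit hV.contDiffOn

/-- Slices of the similarity orbit are smooth. [folklore] -/
theorem contDiff_lerayOrbit_slice_of_typeI (hV : IsTypeIAncientMild C V) (s : ℝ) {n : WithTop ℕ∞}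
    (hn : n ≤ (⊤ : ℕ∞)) : ContDiff ℝ n (lerayOrbit V s) :=
  ((contDiff_uncurry_lerayOrbit_of_typeI hV).comp (contDiff_prodMk_right s)).of_le hn

/-- **Iterated derivatives of a similarity slice**: `DᵏU(s)(y) = c^{k+1} • DᵏV(t)(c y)`,
`c = e^{−s/2} = √(−t)`, `t = −e^{−s}` (chain rule with the homothety `y ↦ c y`). [folklore] -/
theorem iteratedFDeriv_lerayOrbit_slice (hV : IsTypeIAncientMild C V) (s : ℝ) (k : ℕ)
    (y : EuclideanSpace ℝ (Fin 3)) :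
    iteratedFDeriv ℝ k (lerayOrbit V s) y = (Real.exp (-s / 2) ^ (k + 1)) •
      iteratedFDeriv ℝ k (V (-Real.exp (-s))) (Real.exp (-s / 2) • y) := by
  set c : ℝ := Real.exp (-s / 2) with hc
  have ht : -Real.exp (-s) < 0 := neg_neg_of_pos (Real.exp_pos _)
  have hd : ContDiff ℝ k (V (-Real.exp (-s))) := (hV.contDiff_slice ht).of_le (by exact_mod_cast (le_top : (k : ℕ∞) ≤ ⊤))
  set L : EuclideanSpace ℝ (Fin 3) →L[ℝ] EuclideanSpace ℝ (Fin 3) :=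
    c • ContinuousLinearMap.id ℝ (EuclideanSpace ℝ (Fin 3)) with hL
  have hLy : ∀ z, L z = c • z := fun z => by simp [hL]
  have hsl : lerayOrbit V s = c • (V (-Real.exp (-s)) ∘ L) := by
    funext z
    rw [lerayOrbit_slice]
    simp only [Pi.smul_apply, comp_apply, hLy, hc]
  have hgL : ContDiff ℝ k (V (-Real.exp (-s)) ∘ L) := hd.comp L.contDiff
  rw [hsl, iteratedFDeriv_const_smul_apply hgL.contDiffAt, L.iteratedFDeriv_comp_right hd y le_rfl,
    typeIGauge_compContinuousLinearMap_smul_id, smul_smul, hLy, ← pow_succ']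

/-- **Global bounds for the iterated derivatives of the similarity slices**: the class-uniform
scale-invariant gauge bounds `√(−t)^{k+1}‖DᵏV(t)(x)‖ ≤ K` give `‖DᵏU(s)(y)‖ ≤ K` for every `s`.
[folklore] -/
theorem norm_iteratedFDeriv_lerayOrbit_le (hV : IsTypeIAncientMild C V) {k : ℕ} {K : ℝ}
    (hK : ∀ ⦃W : ℝ → EuclideanSpace ℝ (Fin 3) → EuclideanSpace ℝ (Fin 3)⦄, IsTypeIAncientMild C W →
      ∀ t < 0, ∀ x, Real.sqrt (-t) ^ (k + 1) * ‖iteratedFDeriv ℝ k (W t) x‖ ≤ K)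
    (s : ℝ) (y : EuclideanSpace ℝ (Fin 3)) : ‖iteratedFDeriv ℝ k (lerayOrbit V s) y‖ ≤ K := by
  have ht : -Real.exp (-s) < 0 := neg_neg_of_pos (Real.exp_pos _)
  have h := hK hV (-Real.exp (-s)) ht (Real.exp (-s / 2) • y)
  have hsq : Real.sqrt (-(-Real.exp (-s))) = Real.exp (-s / 2) := by
    rw [neg_neg, ← exp_neg_half_sq, Real.sqrt_sq (Real.exp_pos _).le]
  rw [hsq] at h
  rw [iteratedFDeriv_lerayOrbit_slice hV s k y, norm_smul, norm_pow, Real.norm_of_nonneg (Real.exp_pos _).le]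
  exact h

/-- `‖U(s,y)‖ ≤ C` for the similarity orbit of a class element with Type-I constant `C`. [folklore] -/
theorem norm_lerayOrbit_le_of_typeI (hV : IsTypeIAncientMild C V) (s : ℝ) (y : EuclideanSpace ℝ (Fin 3)) :
    ‖lerayOrbit V s y‖ ≤ C := by
  have hpos : 0 < Real.exp (-s / 2) := Real.exp_pos _
  have ht : -Real.exp (-s) < 0 := neg_neg_of_pos (Real.exp_pos _)
  have key := hV.norm_le ht (Real.exp (-s / 2) • y)
  have hsq : Real.sqrt (-(-Real.exp (-s))) = Real.exp (-s / 2) := by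
    rw [neg_neg, ← exp_neg_half_sq, Real.sqrt_sq hpos.le]
  rw [hsq] at key
  rw [lerayOrbit_apply, norm_smul, Real.norm_of_nonneg hpos.le]
  calc Real.exp (-s / 2) * ‖V (-Real.exp (-s)) (Real.exp (-s / 2) • y)‖
      ≤ Real.exp (-s / 2) * (C / Real.exp (-s / 2)) := by gcongr
    _ = C := by field_simp

end Scaling

/-! ### The theorem -/

/-- **T41 (classical level, similarity variables): the Gaussian-gap Liouville theorem for Type-I
ancient mild solutions.** See the module docstring for the statement in words and the proof.
[this file; theory T41 (EXPLICIT-THRESHOLDS / LIOUVILLE-SIDE §8), red ×2: s14 (phys) + s21 (Sim dictionary)] -/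
theorem typeI_ancient_gaussianGap_eq_zero {C Λ Pm μ₀ B : ℝ}
    {V : ℝ → EuclideanSpace ℝ (Fin 3) → EuclideanSpace ℝ (Fin 3)} (hV : IsTypeIAncientMild C V)
    (hstrain : ∀ (s : ℝ) (y : EuclideanSpace ℝ (Fin 3)),
      ⟪fderiv ℝ (lerayOrbit V s) y (lerayVorticity V s y), lerayVorticity V s y⟫ ≤
        Λ * ‖lerayVorticity V s y‖ ^ 2)
    (hflux : ∀ (s : ℝ) (y : EuclideanSpace ℝ (Fin 3)), -⟪y, lerayOrbit V s y⟫ ≤ Pm)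
    (hmean : ∀ s : ℝ, ‖∫ y, heatKernel 1 y • lerayVorticity V s y‖ ^ 2 ≤
      μ₀ * ∫ y, heatKernel 1 y * ‖lerayVorticity V s y‖ ^ 2)
    (hZ : ∀ s : ℝ, ∫ y, heatKernel 1 y * ‖lerayVorticity V s y‖ ^ 2 ≤ B)
    (hbudget : Λ + Pm / 4 + μ₀ / 2 < 3 / 2) :
    ∀ t < 0, ∀ x, V t x = 0 := by
  -- notation
  set U : ℝ → EuclideanSpace ℝ (Fin 3) → EuclideanSpace ℝ (Fin 3) := lerayOrbit V with hU_def
  have hΩ_def : ∀ s, lerayVorticity V s = curl (U s) := fun s => rfl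
  -- smoothness of the slices
  have hUtop : ∀ s, ContDiff ℝ (⊤ : ℕ∞) (U s) := fun s => contDiff_lerayOrbit_slice_of_typeI hV s le_rfl
  have hU3 : ∀ s, ContDiff ℝ 3 (U s) := fun s => (hUtop s).of_le (by norm_cast)
  have hU1 : ∀ s, ContDiff ℝ 1 (U s) := fun s => (hUtop s).of_le (by norm_cast)
  have hΩ2 : ∀ s, ContDiff ℝ 2 (lerayVorticity V s) := fun s => by
    rw [hΩ_def]; exact contDiff_curl (hU3 s)
  have hdiv : ∀ s, VectorCalculus.IsDivFree (U s) := fun s =>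
    (isDivFree_lerayOrbit_iff V s).2 (hV.isDivFree (neg_neg_of_pos (Real.exp_pos _)))
  -- class-uniform scale-invariant gauge bounds, k = 1, 2, 3
  obtain ⟨K₁, hK₁⟩ := typeIGauge_exists_pow_mul_norm_iteratedFDeriv_le C 1
  obtain ⟨K₂, hK₂⟩ := typeIGauge_exists_pow_mul_norm_iteratedFDeriv_le C 2
  obtain ⟨K₃, hK₃⟩ := typeIGauge_exists_pow_mul_norm_iteratedFDeriv_le C 3
  have b1 : ∀ s y, ‖fderiv ℝ (U s) y‖ ≤ K₁ := fun s y => by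
    rw [← norm_iteratedFDeriv_one]; exact norm_iteratedFDeriv_lerayOrbit_le hV hK₁ s y
  have b2 : ∀ s y, ‖iteratedFDeriv ℝ 2 (U s) y‖ ≤ K₂ := fun s y => norm_iteratedFDeriv_lerayOrbit_le hV hK₂ s y
  have b3 : ∀ s y, ‖iteratedFDeriv ℝ 3 (U s) y‖ ≤ K₃ := fun s y => norm_iteratedFDeriv_lerayOrbit_le hV hK₃ s y
  have hK₁0 : 0 ≤ K₁ := (norm_nonneg _).trans (b1 0 0)
  have hK₂0 : 0 ≤ K₂ := (norm_nonneg _).trans (b2 0 0)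
  have hK₃0 : 0 ≤ K₃ := (norm_nonneg _).trans (b3 0 0)
  have hC0 : 0 ≤ C := hV.nonneg
  -- bounds on the similarity vorticity and its derivatives
  have c0 : ∀ s y, ‖lerayVorticity V s y‖ ≤ ‖curlCLM‖ * K₁ := fun s y =>
    (norm_curl_le (U s) y).trans (mul_le_mul_of_nonneg_left (b1 s y) (norm_nonneg curlCLM))
  have hDΩ : ∀ s y, fderiv ℝ (lerayVorticity V s) y = curlCLM.comp (fderiv ℝ (fderiv ℝ (U s)) y) := by
    intro s y
    have hd : DifferentiableAt ℝ (fderiv ℝ (U s)) y :=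
      (((hU3 s).fderiv_right (m := 2) (by norm_cast)).differentiable (by norm_num)) y
    rw [hΩ_def, curl_eq_curlCLM_comp]
    exact (curlCLM.hasFDerivAt.comp y hd.hasFDerivAt).fderiv
  have c1 : ∀ s y, ‖fderiv ℝ (lerayVorticity V s) y‖ ≤ ‖curlCLM‖ * K₂ := by
    intro s y
    rw [hDΩ]
    refine (ContinuousLinearMap.opNorm_comp_le _ _).trans (mul_le_mul_of_nonneg_left ?_ (norm_nonneg _))
    rw [← norm_iteratedFDeriv_one, norm_iteratedFDeriv_fderiv]
    exact b2 s y
  have c2 : ∀ s y, ‖iteratedFDeriv ℝ 2 (lerayVorticity V s) y‖ ≤ ‖curlCLM‖ * K₃ := by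
    intro s y
    have hf2 : ContDiff ℝ 2 (fderiv ℝ (U s)) := (hU3 s).fderiv_right (m := 2) (by norm_cast)
    rw [hΩ_def, curl_eq_curlCLM_comp, curlCLM.iteratedFDeriv_comp_left hf2.contDiffAt le_rfl]
    refine (ContinuousLinearMap.norm_compContinuousMultilinearMap_le _ _).trans
      (mul_le_mul_of_nonneg_left ?_ (norm_nonneg _))
    rw [norm_iteratedFDeriv_fderiv]
    exact b3 s y
  -- the global bound feeding the core theorem
  set K₀ : ℝ := C + K₁ + ‖curlCLM‖ * (K₁ + K₂ + K₃) with hK₀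
  have hcn : 0 ≤ ‖curlCLM‖ := norm_nonneg curlCLM
  have hbdd : ∀ s₀ : ℝ, ∃ ε > 0, ∃ K : ℝ, ∀ s ∈ Ioo (s₀ - ε) (s₀ + ε), ∀ y,
      ‖lerayVorticity V s y‖ ≤ K ∧ ‖fderiv ℝ (lerayVorticity V s) y‖ ≤ K ∧
        ‖iteratedFDeriv ℝ 2 (lerayVorticity V s) y‖ ≤ K ∧ ‖U s y‖ ≤ K ∧ ‖fderiv ℝ (U s) y‖ ≤ K := by
    intro s₀
    refine ⟨1, one_pos, K₀, fun s _ y => ⟨?_, ?_, ?_, ?_, ?_⟩⟩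
    · exact (c0 s y).trans (by rw [hK₀]; nlinarith)
    · exact (c1 s y).trans (by rw [hK₀]; nlinarith)
    · exact (c2 s y).trans (by rw [hK₀]; nlinarith)
    · exact (norm_lerayOrbit_le_of_typeI hV s y).trans (by rw [hK₀]; nlinarith)
    · exact (b1 s y).trans (by rw [hK₀]; nlinarith)
  -- the equation as an `s`-derivative
  have hLO := contDiff_uncurry_lerayOrbit_of_typeI hV
  have hG : ContDiff ℝ 1 fun p : ℝ × EuclideanSpace ℝ (Fin 3) => fderiv ℝ (lerayOrbit V p.1) p.2 := by
    have hf : ContDiff ℝ (⊤ : ℕ∞) (uncurry fun p : ℝ × EuclideanSpace ℝ (Fin 3) => lerayOrbit V p.1) := by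
      have e : (uncurry fun p : ℝ × EuclideanSpace ℝ (Fin 3) => lerayOrbit V p.1) =
          uncurry (lerayOrbit V) ∘ fun q : (ℝ × EuclideanSpace ℝ (Fin 3)) × EuclideanSpace ℝ (Fin 3) =>
            (q.1.1, q.2) := by
        funext q; rfl
      rw [e]
      exact hLO.comp ((contDiff_fst.comp contDiff_fst).prodMk contDiff_snd)
    exact hf.fderiv contDiff_snd (by norm_cast)
  have heq : ∀ s y, HasDerivAt (fun σ => lerayVorticity V σ y)
      ((Δ (lerayVorticity V s)) y - lerayVorticity V s y
        - (1 / 2 : ℝ) • fderiv ℝ (lerayVorticity V s) y y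
        - fderiv ℝ (lerayVorticity V s) y (U s y) + fderiv ℝ (U s) y (lerayVorticity V s y)) s := by
    intro s y
    -- differentiability in `s` from the joint smoothness of the gradient
    have hGd : Differentiable ℝ fun p : ℝ × EuclideanSpace ℝ (Fin 3) => fderiv ℝ (lerayOrbit V p.1) p.2 :=
      hG.differentiable one_ne_zero
    have h1 : DifferentiableAt ℝ (fun σ : ℝ => fderiv ℝ (lerayOrbit V σ) y) s := by
      have hpair : DifferentiableAt ℝ (fun σ : ℝ => ((σ, y) : ℝ × EuclideanSpace ℝ (Fin 3))) s :=
        differentiableAt_id.prodMk (differentiableAt_const y)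
      exact (hGd (s, y)).comp s hpair
    have e : (fun σ => lerayVorticity V σ y) = fun σ => curlCLM (fderiv ℝ (lerayOrbit V σ) y) := by
      funext σ; rfl
    have hdσ : DifferentiableAt ℝ (fun σ => lerayVorticity V σ y) s := by
      rw [e]
      exact curlCLM.differentiableAt.comp s h1
    have hder := hdσ.hasDerivAt
    -- the tree's vorticity equation identifies the derivative
    have key := hV.lerayVorticity_eq s y
    have htd : timeDerivWithin univ (lerayVorticity V) s y = deriv (fun σ => lerayVorticity V σ y) s := by
      rw [timeDerivWithin_apply, derivWithin_univ]
    rw [htd] at key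
    have hval : deriv (fun σ => lerayVorticity V σ y) s =
        (Δ (lerayVorticity V s)) y - lerayVorticity V s y
          - (1 / 2 : ℝ) • fderiv ℝ (lerayVorticity V s) y y
          - fderiv ℝ (lerayVorticity V s) y (U s y) + fderiv ℝ (U s) y (lerayVorticity V s y) := by
      simp only [convect] at key
      rw [← sub_eq_zero]
      have := sub_eq_zero.mpr key
      rw [← this]
      simp only [hU_def]
      abel
    rw [hval] at hder
    exact hder
  -- the core theorem
  have hΩ0 : ∀ s y, lerayVorticity V s y = 0 :=
    gaussianGap_vorticity_liouville (Ω := lerayVorticity V) (U := U) hΩ2 hU1 hdiv hbdd heq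
      hstrain hflux hmean hZ hbudget
  -- back to physical variables: curl-free, divergence-free, bounded slices are constant, hence zero
  have hcurl : ∀ t < 0, ∀ x, curl (V t) x = 0 := by
    intro t ht x
    set s : ℝ := -Real.log (-t) with hs
    have hts : -Real.exp (-s) = t := by
      rw [hs, neg_neg, Real.exp_log (neg_pos.2 ht), neg_neg]
    have h := hΩ0 s ((Real.exp (-s / 2))⁻¹ • x)
    rw [lerayVorticity_apply, curl_lerayOrbit, smul_smul,
      mul_inv_cancel₀ (Real.exp_pos _).ne', one_smul, hts, smul_eq_zero] at h
    exact h.resolve_left (Real.exp_pos _).ne'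
  have hconst : ∀ t < 0, ∀ x, V t x = V t 0 := fun t ht x =>
    eq_of_curl_eq_zero_of_isDivFree_of_bounded ((hV.contDiff_slice ht).of_le (by norm_cast))
      (hcurl t ht) (hV.isDivFree ht) (fun z => hV.norm_le ht z) x 0
  exact fun t ht x => hV.eq_zero_of_slice_const (b := fun t => V t 0) hconst ht x

/-- **T41 without the Gaussian-enstrophy hypothesis** (typer's remark): the class-uniform
scale-invariant gauge bounds make `∫K|Ω(s)|² ≤ ‖curl‖²K₁²` automatic for every `s`, so the bound
`B` of `typeI_ancient_gaussianGap_eq_zero` can be dropped. [this file] -/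
theorem typeI_ancient_gaussianGap_eq_zero' {C Λ Pm μ₀ : ℝ}
    {V : ℝ → EuclideanSpace ℝ (Fin 3) → EuclideanSpace ℝ (Fin 3)} (hV : IsTypeIAncientMild C V)
    (hstrain : ∀ (s : ℝ) (y : EuclideanSpace ℝ (Fin 3)),
      ⟪fderiv ℝ (lerayOrbit V s) y (lerayVorticity V s y), lerayVorticity V s y⟫ ≤
        Λ * ‖lerayVorticity V s y‖ ^ 2)
    (hflux : ∀ (s : ℝ) (y : EuclideanSpace ℝ (Fin 3)), -⟪y, lerayOrbit V s y⟫ ≤ Pm)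
    (hmean : ∀ s : ℝ, ‖∫ y, heatKernel 1 y • lerayVorticity V s y‖ ^ 2 ≤
      μ₀ * ∫ y, heatKernel 1 y * ‖lerayVorticity V s y‖ ^ 2)
    (hbudget : Λ + Pm / 4 + μ₀ / 2 < 3 / 2) :
    ∀ t < 0, ∀ x, V t x = 0 := by
  obtain ⟨K₁, hK₁⟩ := typeIGauge_exists_pow_mul_norm_iteratedFDeriv_le C 1
  have b1 : ∀ s y, ‖fderiv ℝ (lerayOrbit V s) y‖ ≤ K₁ := fun s y => by
    rw [← norm_iteratedFDeriv_one]; exact norm_iteratedFDeriv_lerayOrbit_le hV hK₁ s y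
  have c0 : ∀ s y, ‖lerayVorticity V s y‖ ≤ ‖curlCLM‖ * K₁ := fun s y =>
    (norm_curl_le (lerayOrbit V s) y).trans (mul_le_mul_of_nonneg_left (b1 s y) (norm_nonneg curlCLM))
  have hZ : ∀ s : ℝ, ∫ y, heatKernel 1 y * ‖lerayVorticity V s y‖ ^ 2 ≤ (‖curlCLM‖ * K₁) ^ 2 := by
    intro s
    have hc : Continuous (lerayVorticity V s) :=
      continuous_curl (contDiff_lerayOrbit_slice_of_typeI hV s (n := 1) (by norm_cast))
    have iZ : Integrable fun y => heatKernel 1 y * ‖lerayVorticity V s y‖ ^ 2 :=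
      integrable_of_le_poly_heatKernel ((continuous_heatKernel 1).mul (hc.norm.pow 2))
        (C := (‖curlCLM‖ * K₁) ^ 2) (N := 0) fun y => by
          rw [Real.norm_eq_abs, abs_mul, abs_of_pos (heatKernel_one_pos y),
            abs_of_nonneg (by positivity), pow_zero, mul_one, mul_comm]
          exact mul_le_mul_of_nonneg_right (pow_le_pow_left₀ (norm_nonneg _) (c0 s y) 2)
            (heatKernel_one_pos y).le
    have h1 : ∫ y, heatKernel 1 y * ‖lerayVorticity V s y‖ ^ 2 ≤
        ∫ y, (‖curlCLM‖ * K₁) ^ 2 * heatKernel 1 y :=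
      integral_mono iZ ((integrable_heatKernel_holds one_pos).const_mul _) fun y => by
        have := pow_le_pow_left₀ (norm_nonneg _) (c0 s y) 2
        have hk := (heatKernel_one_pos y).le
        show heatKernel 1 y * ‖lerayVorticity V s y‖ ^ 2 ≤ (‖curlCLM‖ * K₁) ^ 2 * heatKernel 1 y
        nlinarith
    rw [integral_const_mul, integral_heatKernel_eq_one_holds one_pos, mul_one] at h1
    exact h1
  exact typeI_ancient_gaussianGap_eq_zero hV hstrain hflux hmean hZ hbudget

/-- **`GaussianGapTypeISim` — the theory seat's statement, binder for binder** (pub-ns-dss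
HOME/theory/GaussianGapStatements.lean v2 sha256[16] 7d1058abdd5585ce, `E3` written out):
T41 at classical level in similarity variables. Proof: `typeI_ancient_gaussianGap_eq_zero`.
[this file; theory T41] -/
theorem gaussianGapTypeISim :
    ∀ (C Λ Pm μ₀ B : ℝ) (V : ℝ → EuclideanSpace ℝ (Fin 3) → EuclideanSpace ℝ (Fin 3)),
    IsTypeIAncientMild C V →
    (∀ (s : ℝ) (y : EuclideanSpace ℝ (Fin 3)),
      ⟪fderiv ℝ (lerayOrbit V s) y (lerayVorticity V s y), lerayVorticity V s y⟫ ≤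
        Λ * ‖lerayVorticity V s y‖ ^ 2) →
    (∀ (s : ℝ) (y : EuclideanSpace ℝ (Fin 3)), -⟪y, lerayOrbit V s y⟫ ≤ Pm) →
    (∀ s : ℝ,
      ‖∫ y, heatKernel 1 y • lerayVorticity V s y‖ ^ 2 ≤
        μ₀ * ∫ y, heatKernel 1 y * ‖lerayVorticity V s y‖ ^ 2) →
    (∀ s : ℝ, ∫ y, heatKernel 1 y * ‖lerayVorticity V s y‖ ^ 2 ≤ B) →
    Λ + Pm / 4 + μ₀ / 2 < 3 / 2 →
    ∀ t < 0, ∀ x, V t x = 0 := by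
  intro C Λ Pm μ₀ B V hV hstrain hflux hmean hZ hbudget
  exact typeI_ancient_gaussianGap_eq_zero hV hstrain hflux hmean hZ hbudget

end Summit.NavierStokesRegularity.NavierStokesRegularity.Theorems.GaussianGap

end
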